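import Mathlib.Geometry.Manifold.VectorField.Pullback
import Literature.Geometry.Lorentzian.ConnectionNaturality
import Literature.Geometry.Lorentzian.LorentzianMetric
import Literature.Geometry.Lorentzian.Basic
import Literature.Geometry.Lorentzian.CoordCurvature
import HarnessLib

/-!
# Crux `GapExhaustion` (stmt-FinalStateConjecture-10808), line `photon-shell-pseudoconvexity`:
# stub (G5-A1) `stub_contDiffOn_pullbackField` — smoothness of the pulled-back vector field

Route `BartnikGapSettling`; helper (`--supports stmt-FinalStateConjecture-10808`) landing the
registered sub-stub (G5-A1) of theme G5 (the chart bridge between the manifold-level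
`IsKillingFieldOn` and the coordinate Killing equation). For an immersed chart
`Ψ : E4 → 𝓢.carrier` of a spacetime `𝓢` (smooth on the open `W ⊆ E4`, injective differential on
`W`) and a `C^∞` section `K` of the tangent bundle on the image `Ψ '' W`, the pulled-back field
`Kt y := (dΨ_y)⁻¹ (K (Ψ y))` is `C^∞` on `W`.

Proof: pointwise `Kt` is Mathlib's pullback of vector fields `VectorField.mpullback 𝓘(ℝ, E4) (𝓡 4) Ψ K`
(`VectorField.mpullback_apply`, definitional); the differentials `dΨ_y`, `y ∈ W`, are invertible
(equidimensional immersion, `isInvertible_mfderiv_of_injective`); Mathlib's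
`ContMDiffWithinAt.mpullback_vectorField_preimage` gives `C^∞`-regularity of the pulled-back
section within `Ψ ⁻¹' (Ψ '' W) ⊇ W` at every `y ∈ W`, and over the model vector space `E4`
section-regularity is `ContDiffOn` (`contMDiffOn_vectorSpace_iff_contDiffOn`). Mathlib + the
tree's `isInvertible_mfderiv_of_injective` only.
-/

noncomputable section

-- instance search through the nested operator types `E4 →L[ℝ] E4 →L[ℝ] E4 →L[ℝ] ℝ`
set_option maxSynthPendingDepth 3

-- D-0017: single-problem summit, `Summit.<S>.<S>.…` by design (cf. lakefile `weak.linter.dupNamespace`).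
set_option linter.dupNamespace false

namespace Summit.FinalStateConjecture.FinalStateConjecture.Theorems

open Set Literature.Geometry.Lorentzian Literature.Geometry.Lorentzian.MetricCoord
open scoped Manifold ContDiff Topology

/-- The pulled-back section `y ↦ (dΨ_y)⁻¹ (K (Ψ y))` of the (trivial) tangent bundle of `E4` is
`C^∞` within `W` at every point of `W`, in the manifold sense: Mathlib's
`ContMDiffWithinAt.mpullback_vectorField_preimage` at `y ∈ W` (the section `K` is `C^∞` within
`Ψ '' W` at `Ψ y`, `Ψ` is `C^∞` at `y` as `W` is open, `dΨ_y` is invertible as an injective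
endomorphism of `E4`), restricted from `Ψ ⁻¹' (Ψ '' W)` to `W`. [folklore] -/
private theorem pullbackField_contMDiffOn (𝓢 : Spacetime.{0} 4) (Ψ : E4 → 𝓢.carrier)
    (W : Set E4) (K : Π x : 𝓢.carrier, TangentSpace (𝓡 4) x) (hW : IsOpen W)
    (hΨ : ContMDiffOn 𝓘(ℝ, E4) (𝓡 4) ∞ Ψ W)
    (hinj : ∀ y ∈ W, Function.Injective (mfderiv 𝓘(ℝ, E4) (𝓡 4) Ψ y))
    (hK : ContMDiffOn (𝓡 4) ((𝓡 4).prod 𝓘(ℝ, E4)) ∞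
      (fun x ↦ (Bundle.TotalSpace.mk' E4 x (K x) : TangentBundle (𝓡 4) 𝓢.carrier)) (Ψ '' W)) :
    ContMDiffOn 𝓘(ℝ, E4) (𝓘(ℝ, E4).prod 𝓘(ℝ, E4)) ∞
      (fun y ↦ (Bundle.TotalSpace.mk' E4 y (VectorField.mpullback 𝓘(ℝ, E4) (𝓡 4) Ψ K y) :
        TangentBundle 𝓘(ℝ, E4) E4)) W := by
  intro y hy
  have hΨy : ContMDiffAt 𝓘(ℝ, E4) (𝓡 4) ∞ Ψ y := (hΨ y hy).contMDiffAt (hW.mem_nhds hy)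
  have hinv : (mfderiv 𝓘(ℝ, E4) (𝓡 4) Ψ y).IsInvertible :=
    PseudoRiemannianMetric.isInvertible_mfderiv_of_injective (I := 𝓡 4) (I' := 𝓘(ℝ, E4)) rfl
      (hinj y hy)
  have h := ContMDiffWithinAt.mpullback_vectorField_preimage (I := 𝓘(ℝ, E4)) (I' := 𝓡 4)
    (m := ∞) (n := ∞) (V := K) (hK (Ψ y) (mem_image_of_mem Ψ hy)) hΨy hinv (by simp)
  exact h.mono (subset_preimage_image Ψ W)

/-- **Stub (G5-A1) of the line `photon-shell-pseudoconvexity` (crux `GapExhaustion`,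
stmt-FinalStateConjecture-10808) — smoothness of the pulled-back field.** For a spacetime `𝓢`,
a map `Ψ : E4 → 𝓢.carrier` which is `C^∞` on the open set `W` with injective differential at
every point of `W`, and a section `K` of the tangent bundle of `𝓢.carrier` which is `C^∞` on
`Ψ '' W`, the pulled-back field `y ↦ (dΨ_y)⁻¹ (K (Ψ y))` is `C^∞` on `W` (it is Mathlib's
`VectorField.mpullback 𝓘(ℝ, E4) (𝓡 4) Ψ K`, and section-regularity over the model vector space
`E4` is `ContDiffOn`). O'Neill 1983, Ch. 1, Lemma 1.31 ff. (equidimensional immersions are local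
diffeomorphisms, so vector fields pull back smoothly). [cite: ONeill1983, Ch. 1, Lemma 1.31] -/
theorem stub_contDiffOn_pullbackField :
    ∀ (𝓢 : Spacetime.{0} 4) (Ψ : E4 → 𝓢.carrier) (W : Set E4)
      (K : Π x : 𝓢.carrier, TangentSpace (𝓡 4) x),
      IsOpen W → ContMDiffOn 𝓘(ℝ, E4) (𝓡 4) ∞ Ψ W →
      (∀ y ∈ W, Function.Injective (mfderiv 𝓘(ℝ, E4) (𝓡 4) Ψ y)) →
      ContMDiffOn (𝓡 4) ((𝓡 4).prod 𝓘(ℝ, E4)) ∞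
        (fun x ↦ (Bundle.TotalSpace.mk' E4 x (K x) : TangentBundle (𝓡 4) 𝓢.carrier)) (Ψ '' W) →
      ContDiffOn ℝ ∞ (fun y : E4 => (mfderiv 𝓘(ℝ, E4) (𝓡 4) Ψ y).inverse (K (Ψ y))) W := by
  intro 𝓢 Ψ W K hW hΨ hinj hK
  exact contMDiffOn_vectorSpace_iff_contDiffOn.1 (pullbackField_contMDiffOn 𝓢 Ψ W K hW hΨ hinj hK)

end Summit.FinalStateConjecture.FinalStateConjecture.Theorems

end
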